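/-
Literature file (hubbard-downfold multi-orbital front-end, router branch `UND:MULTIORB(k = 3; J_H)`, and the
alkali-fulleride rows A₃C₆₀ / Cs₃C₆₀ fcc–A15 of the validation set): the full term spectrum of the
rotationally invariant three-orbital Kanamori atom (Georges–de' Medici–Mravlje 2013, eq. (7) and Table 1),
Hund's first two rules for `J > 0`, their complete INVERSION for `J < 0` (the «inverted Hund's coupling» of
Jahn–Teller-coupled C₆₀ⁿ⁻, Capone–Fabrizio–Castellani–Tosatti 2009), the resulting atomic Mott gaps at every
filling for both signs of `J`, and the exact dictionary between the two printed parameterisations.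
Companion of `KanamoriAtomicMottGap` (which treats the density–density functional on the maximal-`S_z`
pattern for general `M`); here `M = 3` with the exchange and pair-hopping terms included, multiplet by multiplet.
-/
import Literature.MathematicalPhysics.QuantumManyBody.KanamoriAtomicMottGap
import HarnessLib

/-!
# The `t₂g` / `t₁ᵤ` Kanamori atom: term energies, Hund's rules and their inversion, Mott gaps

For three degenerate orbitals with the rotationally invariant Kanamori interaction (`U' = U − 2J`) the
atomic Hamiltonian is a function of the conserved total charge, spin and orbital pseudo-angular momentum,
`H_{t2g} = (U − 3J) N̂(N̂−1)/2 − 2J S⃗² − (J/2) L⃗² + (5/2) J N̂`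
[cite: GeorgesMediciMravlje2013, eq. (7)], so every eigenvalue is read off a term `(N, S, L)`; the terms that
occur and their energies are printed in their Table 1 («Eigenstates and eigenvalues of the t₂g Hamiltonian
`𝒰N̂(N̂−1)/2 − 2J S⃗² − J L⃗²/2` in the atomic limit (`𝒰 ≡ U − 3J`)», i.e. the table omits the `(5/2)JN̂`
shift): `N = 1: (½, 1)`; `N = 2: (1,1), (0,2), (0,0)`; `N = 3: (3/2,0), (½,2), (½,1)`, with the `N = 4, 5, 6`
partners in brackets. For alkali fullerides A₃C₆₀ the three `t₁ᵤ` LUMO orbitals play the role of the `t₂g`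
triplet and the SAME operator form is used with the opposite sign convention,
`H_U + H_J = (U/2)(n − 3)² + J(2S⃗·S⃗ + ½ L⃗·L⃗) + (5/6) J (n − 3)²`, «where `J = −J_H < 0`» for pure Hund
exchange and `J = −J_H + J_JT > 0` once the unretarded Jahn–Teller exchange is added — «an inverted Hund's rule
coupling» [cite: CaponeEtAl2009, §III eqs. (1)–(2) and the paragraph following].

## Contents (everything PROVED from the two printed forms; no named facts)

* `Term`, `deg`, the thirteen printed terms `p0 … p6`, `termsAt`; `deg_sum` — the degeneracies of Table 1 add
  up to `C(6, N)` in every charge sector (all `64` states accounted for, `card_total`).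
* `tableEnergy 𝒰 J` (Table 1 Hamiltonian), `energy U J` (eq. (7)); `table1` — the printed entries, incl. the
  bracketed particle–hole partners; `energy_values` — eq. (7) values `0, 0, U−3J | U−J | U+2J, 3U−9J | 3U−6J |
  3U−4J, 6U−13J | 6U−11J | 6U−8J, 10U−20J, 15U−30J`; `tableEnergy_particleHole`.
* HUND'S RULES (`J > 0`): `hund_order_two/three/four` — strict order ³P < ¹D < ¹S, ⁴S < ²D < ²P (maximal `S`,
  then maximal `L`) [GdMM «In this form, Hund's first two rules … are evident»]; INVERSION (`J < 0`):
  `inverted_order_two/three/four` — the order reverses completely: nondegenerate ¹S ground term at `N = 2, 4`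
  and the low-spin ²P (`S = ½`) ground term at `N = 3` [CFCT «favors a low-spin ground state», «Mott–Jahn–Teller
  insulators … sites in a JT stabilized low-spin state (as opposed to a Hund's rule stabilized high-spin state)»].
* Ground energies `e0Hund`, `e0Inv` with `e0Hund_le` / `e0Inv_le` (minimality in each sector under the sign
  hypothesis) and the atomic gaps `gap e0 N = e0(N+1) + e0(N−1) − 2e0(N)`:
  `gap_hund` — `U − 3J` at `N = 1, 2, 4, 5`, `U + 2J` at `N = 3` (= `KanamoriAtomicMottGap.t2g_gaps`,
  cross-checked in `gap_hund_eq_atomicGap`, and `e0Hund_eq_ddEnergy_hund`: the Hund term energy IS the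
  density–density energy of the maximal-`S_z` pattern, GdMM's «exchange and pair-hopping terms have no action»);
  `gap_inv` — for `J ≤ 0`: `U + 2J = U − 2|J|` at `N = 1, 3, 5` (REDUCED) and `U − 8J = U + 8|J|` at `N = 2, 4`
  (ENHANCED): the inverted coupling brings the half-filled (A₃C₆₀) shell closer to charge fluctuations and pushes
  the `N = 2, 4` (A₂C₆₀/A₄C₆₀-type) shells away — spin gaps `spinGap_three/four = −5J`.
* CFCT's own parameterisation: `caponeEnergy`, the dictionary `caponeEnergy_eq` (`U_C = U − (4/3)J`,
  `J_C = −J`, equal up to an affine function of `N`), and in THEIR letters: spin gaps `= 5J_C` at `n = 3` and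
  `n = 4` [cite: CaponeEtAl2009, §IV («both gaps are equal to 5J»)], half-filled gap `U_C − (10/3)J_C`
  (their Cooper-channel amplitude «A = −10J/3 + U»), generic gap `U_C + (20/3)J_C`; the printed ranges
  `J_H ≈ 0.03–0.1`, `J_JT ≈ 0.06–0.12 eV` give `J_C = J_JT − J_H ∈ [−0.04, 0.09] eV` by corners — the sign is NOT
  fixed by those two ranges alone (`capone_J_interval`), CFCT fix it by the spin gap (`J ≈ 0.02 eV`).

WHAT THIS IS NOT: a derivation of eq. (7) from the second-quantised `H_K` on Fock space (the operator identity
GdMM eq. (5) is the cited INPUT; TODO(general form): `H_K` as an operator and `M ≠ 3`), nor a statement about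
the solid (bandwidth `W`, Jahn–Teller phonon dynamics, retardation — CFCT §III), nor about any material's `U, J`.
-/

noncomputable section

namespace Literature.MathematicalPhysics.QuantumManyBody

namespace KanamoriT2gSpectrum

/-! ## Terms `(N, S, L)` of the three-orbital shell -/

/-- A term (multiplet label) of the three-orbital atom: electron number `N`, twice the total spin `2S`, and the
orbital pseudo-angular momentum `L`. [cite: GeorgesMediciMravlje2013, Table 1 (columns N, S, L)] -/
structure Term where
  /-- electron number `N` -/
  N : ℕ
  /-- twice the spin, `2S` -/
  twoS : ℕ
  /-- orbital angular momentum `L` -/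
  L : ℕ
deriving DecidableEq, Repr

/-- Degeneracy `(2S+1)(2L+1)` of a term. [cite: GeorgesMediciMravlje2013, Table 1 (column «Degeneracy =(2S+1)(2L+1)»)] -/
def deg (t : Term) : ℕ := (t.twoS + 1) * (2 * t.L + 1)

/-- `N = 0`: ¹S `(0, 0)`. [cite: GeorgesMediciMravlje2013, Table 1 (row N = 0)] -/
def p0 : Term := ⟨0, 0, 0⟩
/-- `N = 1`: ²P `(½, 1)`, sixfold. [cite: GeorgesMediciMravlje2013, Table 1 (row N = 1)] -/
def p1 : Term := ⟨1, 1, 1⟩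
/-- `N = 2`: ³P `(1, 1)`, ninefold (Hund ground term). [cite: GeorgesMediciMravlje2013, Table 1 (rows N = 2)] -/
def p2P : Term := ⟨2, 2, 1⟩
/-- `N = 2`: ¹D `(0, 2)`, fivefold. [cite: GeorgesMediciMravlje2013, Table 1 (rows N = 2)] -/
def p2D : Term := ⟨2, 0, 2⟩
/-- `N = 2`: ¹S `(0, 0)`, nondegenerate. [cite: GeorgesMediciMravlje2013, Table 1 (rows N = 2)] -/
def p2S : Term := ⟨2, 0, 0⟩
/-- `N = 3`: ⁴S `(3/2, 0)`, fourfold (Hund ground term). [cite: GeorgesMediciMravlje2013, Table 1 (rows N = 3)] -/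
def p3S : Term := ⟨3, 3, 0⟩
/-- `N = 3`: ²D `(½, 2)`, tenfold. [cite: GeorgesMediciMravlje2013, Table 1 (rows N = 3)] -/
def p3D : Term := ⟨3, 1, 2⟩
/-- `N = 3`: ²P `(½, 1)`, sixfold (the low-spin term). [cite: GeorgesMediciMravlje2013, Table 1 (rows N = 3)] -/
def p3P : Term := ⟨3, 1, 1⟩
/-- `N = 4`: ³P `(1, 1)` (particle–hole partner of `p2P`). [cite: GeorgesMediciMravlje2013, Table 1 (bracketed N = 4)] -/
def p4P : Term := ⟨4, 2, 1⟩
/-- `N = 4`: ¹D `(0, 2)`. [cite: GeorgesMediciMravlje2013, Table 1 (bracketed N = 4)] -/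
def p4D : Term := ⟨4, 0, 2⟩
/-- `N = 4`: ¹S `(0, 0)`. [cite: GeorgesMediciMravlje2013, Table 1 (bracketed N = 4)] -/
def p4S : Term := ⟨4, 0, 0⟩
/-- `N = 5`: ²P `(½, 1)`. [cite: GeorgesMediciMravlje2013, Table 1 (bracketed N = 5)] -/
def p5 : Term := ⟨5, 1, 1⟩
/-- `N = 6`: ¹S `(0, 0)` (full shell). [cite: GeorgesMediciMravlje2013, Table 1 (bracketed N = 6)] -/
def p6 : Term := ⟨6, 0, 0⟩

/-- The complete printed term list of the three-orbital shell. [cite: GeorgesMediciMravlje2013, Table 1] -/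
def terms : List Term := [p0, p1, p2P, p2D, p2S, p3S, p3D, p3P, p4P, p4D, p4S, p5, p6]

/-- The terms of charge sector `N`. [cite: GeorgesMediciMravlje2013, Table 1] -/
def termsAt (N : ℕ) : List Term := terms.filter fun t => t.N = N

/-- STATE COUNT: in every sector the printed degeneracies add up to `C(6, N)` — the `6, 15, 20, 15, 6` states of
`N = 1 … 5` electrons in six spin-orbitals are exactly the listed terms.
[cite: GeorgesMediciMravlje2013, Table 1 (column Degeneracy)] -/
theorem deg_sum (N : ℕ) (hN : N ≤ 6) : ((termsAt N).map deg).sum = Nat.choose 6 N := by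
  interval_cases N <;> decide

/-- All `2⁶ = 64` Fock states are accounted for by the thirteen terms. [cite: GeorgesMediciMravlje2013, Table 1] -/
theorem card_total : (terms.map deg).sum = 64 := by decide

/-! ## The two printed energy functions -/

/-- `S(S+1)` of a term, from `2S`. [cite: GeorgesMediciMravlje2013, eq. (7) (the operator `S⃗²`)] -/
def spinSq (t : Term) : ℝ := (t.twoS : ℝ) / 2 * ((t.twoS : ℝ) / 2 + 1)

/-- `L(L+1)` of a term. [cite: GeorgesMediciMravlje2013, eq. (7) (the operator `L⃗²`)] -/
def orbSq (t : Term) : ℝ := (t.L : ℝ) * ((t.L : ℝ) + 1)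

/-- The TABLE-1 Hamiltonian `𝒰 N(N−1)/2 − 2J S(S+1) − (J/2) L(L+1)` evaluated on a term (`𝒰 ≡ U − 3J`; the
`(5/2)JN` shift of eq. (7) omitted, as in the table). [cite: GeorgesMediciMravlje2013, Table 1 (caption)] -/
def tableEnergy (𝒰 J : ℝ) (t : Term) : ℝ :=
  𝒰 * ((t.N : ℝ) * ((t.N : ℝ) - 1) / 2) - 2 * J * spinSq t - J / 2 * orbSq t

/-- The rotationally invariant `t₂g` Kanamori atom, eq. (7):
`H = (U − 3J) N(N−1)/2 − 2J S⃗² − (J/2) L⃗² + (5/2) J N`, evaluated on a term. [cite: GeorgesMediciMravlje2013, eq. (7)] -/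
def energy (U J : ℝ) (t : Term) : ℝ := tableEnergy (U - 3 * J) J t + 5 / 2 * J * (t.N : ℝ)

/-- TABLE 1 AS PRINTED (with `𝒰 = U − 3J` a free symbol): `0; −5J/2; 𝒰−5J, 𝒰−3J, 𝒰; 3𝒰−15J/2, 3𝒰−9J/2,
3𝒰−5J/2`; bracketed partners `6𝒰−5J, 6𝒰−3J, 6𝒰; 10𝒰−5J/2; 15𝒰`. [cite: GeorgesMediciMravlje2013, Table 1] -/
theorem table1 (𝒰 J : ℝ) :
    tableEnergy 𝒰 J p0 = 0 ∧ tableEnergy 𝒰 J p1 = -(5 / 2) * J ∧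
    tableEnergy 𝒰 J p2P = 𝒰 - 5 * J ∧ tableEnergy 𝒰 J p2D = 𝒰 - 3 * J ∧ tableEnergy 𝒰 J p2S = 𝒰 ∧
    tableEnergy 𝒰 J p3S = 3 * 𝒰 - 15 / 2 * J ∧ tableEnergy 𝒰 J p3D = 3 * 𝒰 - 9 / 2 * J ∧
    tableEnergy 𝒰 J p3P = 3 * 𝒰 - 5 / 2 * J ∧
    tableEnergy 𝒰 J p4P = 6 * 𝒰 - 5 * J ∧ tableEnergy 𝒰 J p4D = 6 * 𝒰 - 3 * J ∧ tableEnergy 𝒰 J p4S = 6 * 𝒰 ∧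
    tableEnergy 𝒰 J p5 = 10 * 𝒰 - 5 / 2 * J ∧ tableEnergy 𝒰 J p6 = 15 * 𝒰 := by
  simp only [tableEnergy, spinSq, orbSq, p0, p1, p2P, p2D, p2S, p3S, p3D, p3P, p4P, p4D, p4S, p5, p6]
  push_cast
  refine ⟨?_, ?_, ?_, ?_, ?_, ?_, ?_, ?_, ?_, ?_, ?_, ?_, ?_⟩ <;> ring

/-- EQ. (7) VALUES (shift included): `N = 0, 1: 0`; `N = 2: U−3J (³P), U−J (¹D), U+2J (¹S)`;
`N = 3: 3U−9J (⁴S), 3U−6J (²D), 3U−4J (²P)`; `N = 4: 6U−13J, 6U−11J, 6U−8J`; `N = 5: 10U−20J`; `N = 6: 15U−30J`.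
[cite: GeorgesMediciMravlje2013, eq. (7) with Table 1] -/
theorem energy_values (U J : ℝ) :
    energy U J p0 = 0 ∧ energy U J p1 = 0 ∧
    energy U J p2P = U - 3 * J ∧ energy U J p2D = U - J ∧ energy U J p2S = U + 2 * J ∧
    energy U J p3S = 3 * U - 9 * J ∧ energy U J p3D = 3 * U - 6 * J ∧ energy U J p3P = 3 * U - 4 * J ∧
    energy U J p4P = 6 * U - 13 * J ∧ energy U J p4D = 6 * U - 11 * J ∧ energy U J p4S = 6 * U - 8 * J ∧
    energy U J p5 = 10 * U - 20 * J ∧ energy U J p6 = 15 * U - 30 * J := by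
  simp only [energy, tableEnergy, spinSq, orbSq, p0, p1, p2P, p2D, p2S, p3S, p3D, p3P, p4P, p4D, p4S, p5, p6]
  push_cast
  refine ⟨?_, ?_, ?_, ?_, ?_, ?_, ?_, ?_, ?_, ?_, ?_, ?_, ?_⟩ <;> ring

/-- PARTICLE–HOLE PARTNERS: a term `(6 − N, S, L)` has Table-1 energy `E(N, S, L) + 𝒰 (15 − 5N)` (the
bracketed entries). [cite: GeorgesMediciMravlje2013, Table 1 (bracketed values)] -/
theorem tableEnergy_particleHole (𝒰 J : ℝ) (N s l : ℕ) (hN : N ≤ 6) :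
    tableEnergy 𝒰 J ⟨6 - N, s, l⟩ = tableEnergy 𝒰 J ⟨N, s, l⟩ + 𝒰 * (15 - 5 * (N : ℝ)) := by
  simp only [tableEnergy, spinSq, orbSq]
  rw [Nat.cast_sub hN]
  push_cast
  ring

/-- The `(5/2)JN` shift is affine in `N`: `energy = tableEnergy(U − 3J) + (5/2) J N` — it moves no level
WITHIN a charge sector and drops out of every second difference in `N`. [cite: GeorgesMediciMravlje2013, eq. (7) vs Table 1 caption] -/
theorem energy_sub_tableEnergy (U J : ℝ) (t : Term) :
    energy U J t - tableEnergy (U - 3 * J) J t = 5 / 2 * J * (t.N : ℝ) := by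
  simp only [energy]
  ring

/-! ## Hund's first two rules (`J > 0`) and their complete inversion (`J < 0`) -/

/-- HUND, `N = 2`: ³P `<` ¹D `<` ¹S for `J > 0` (maximal `S`, then maximal `L`).
[cite: GeorgesMediciMravlje2013, eq. (7) («Hund's first two rules (maximal S, then maximal L) are evident»), Table 1 (boxed N = 2)] -/
theorem hund_order_two {U J : ℝ} (hJ : 0 < J) :
    energy U J p2P < energy U J p2D ∧ energy U J p2D < energy U J p2S := by
  obtain ⟨-, -, h1, h2, h3, -⟩ := energy_values U J
  rw [h1, h2, h3]
  constructor <;> linarith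

/-- HUND, `N = 3`: ⁴S `<` ²D `<` ²P for `J > 0` (high spin `S = 3/2` ground term).
[cite: GeorgesMediciMravlje2013, eq. (7), Table 1 (boxed N = 3)] -/
theorem hund_order_three {U J : ℝ} (hJ : 0 < J) :
    energy U J p3S < energy U J p3D ∧ energy U J p3D < energy U J p3P := by
  obtain ⟨-, -, -, -, -, h1, h2, h3, -⟩ := energy_values U J
  rw [h1, h2, h3]
  constructor <;> linarith

/-- HUND, `N = 4`: ³P `<` ¹D `<` ¹S for `J > 0`. [cite: GeorgesMediciMravlje2013, eq. (7), Table 1 (bracketed N = 4)] -/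
theorem hund_order_four {U J : ℝ} (hJ : 0 < J) :
    energy U J p4P < energy U J p4D ∧ energy U J p4D < energy U J p4S := by
  obtain ⟨-, -, -, -, -, -, -, -, h1, h2, h3, -⟩ := energy_values U J
  rw [h1, h2, h3]
  constructor <;> linarith

/-- INVERTED HUND, `N = 2`: for `J < 0` the order reverses, ¹S `<` ¹D `<` ³P — a nondegenerate singlet ground
term. [cite: CaponeEtAl2009, §II («in a JT distorted molecule the ground state maximizes double occupancy of
levels, thus favoring low total spin») with GeorgesMediciMravlje2013 eq. (7)] -/
theorem inverted_order_two {U J : ℝ} (hJ : J < 0) :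
    energy U J p2S < energy U J p2D ∧ energy U J p2D < energy U J p2P := by
  obtain ⟨-, -, h1, h2, h3, -⟩ := energy_values U J
  rw [h1, h2, h3]
  constructor <;> linarith

/-- INVERTED HUND, `N = 3` (C₆₀³⁻): for `J < 0`, ²P `<` ²D `<` ⁴S — the LOW-SPIN `S = ½` term is the ground term
and the Hund term ⁴S the highest. [cite: CaponeEtAl2009, §II («This narrow balance favors a low-spin ground
state … S = 1/2 … their high spin state S = 3/2 lying about 100 meV higher»)] -/
theorem inverted_order_three {U J : ℝ} (hJ : J < 0) :
    energy U J p3P < energy U J p3D ∧ energy U J p3D < energy U J p3S := by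
  obtain ⟨-, -, -, -, -, h1, h2, h3, -⟩ := energy_values U J
  rw [h1, h2, h3]
  constructor <;> linarith

/-- INVERTED HUND, `N = 4` (C₆₀⁴⁻): for `J < 0`, ¹S `<` ¹D `<` ³P (nonmagnetic singlet ground term).
[cite: CaponeEtAl2009, §IV («low spin ground state with … S = 0 for … n = 4»)] -/
theorem inverted_order_four {U J : ℝ} (hJ : J < 0) :
    energy U J p4S < energy U J p4D ∧ energy U J p4D < energy U J p4P := by
  obtain ⟨-, -, -, -, -, -, -, -, h1, h2, h3, -⟩ := energy_values U J
  rw [h1, h2, h3]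
  constructor <;> linarith

/-- At `J = 0` all terms of a sector are degenerate (`SU(6)` limit): the energy depends on `N` only.
[cite: GeorgesMediciMravlje2013, eq. (7)] -/
theorem energy_J_zero (U : ℝ) (t : Term) : energy U 0 t = U * ((t.N : ℝ) * ((t.N : ℝ) - 1) / 2) := by
  simp only [energy, tableEnergy]
  ring

/-- SPIN GAP at `N = 3`: `E(⁴S) − E(²P) = −5J` (positive iff `J < 0`). [cite: CaponeEtAl2009, §IV («both gaps are equal to 5J»), in GdMM letters] -/
theorem spinGap_three (U J : ℝ) : energy U J p3S - energy U J p3P = -5 * J := by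
  obtain ⟨-, -, -, -, -, h1, -, h3, -⟩ := energy_values U J
  rw [h1, h3]; ring

/-- SPIN GAP at `N = 4`: `E(³P) − E(¹S) = −5J`. [cite: CaponeEtAl2009, §IV («both gaps are equal to 5J»), in GdMM letters] -/
theorem spinGap_four (U J : ℝ) : energy U J p4P - energy U J p4S = -5 * J := by
  obtain ⟨-, -, -, -, -, -, -, -, h1, -, h3, -⟩ := energy_values U J
  rw [h1, h3]; ring

/-! ## Ground energies per sector and the atomic Mott gaps, both signs of `J` -/

/-- Ground-term energy of sector `N` under HUND order (`J ≥ 0`): `0, 0, U−3J, 3U−9J, 6U−13J, 10U−20J, 15U−30J`.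
[cite: GeorgesMediciMravlje2013, Table 1 (boxed ground multiplets) with eq. (7)] -/
def e0Hund (U J : ℝ) : ℕ → ℝ
  | 0 => 0
  | 1 => 0
  | 2 => U - 3 * J
  | 3 => 3 * U - 9 * J
  | 4 => 6 * U - 13 * J
  | 5 => 10 * U - 20 * J
  | 6 => 15 * U - 30 * J
  | _ => 0

/-- Ground-term energy of sector `N` under INVERTED order (`J ≤ 0`): `0, 0, U+2J, 3U−4J, 6U−8J, 10U−20J, 15U−30J`.
[cite: CaponeEtAl2009, §II–§IV (low-spin ground states of C₆₀ⁿ⁻) with GeorgesMediciMravlje2013 eq. (7)] -/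
def e0Inv (U J : ℝ) : ℕ → ℝ
  | 0 => 0
  | 1 => 0
  | 2 => U + 2 * J
  | 3 => 3 * U - 4 * J
  | 4 => 6 * U - 8 * J
  | 5 => 10 * U - 20 * J
  | 6 => 15 * U - 30 * J
  | _ => 0

/-- `e0Hund N` is a LOWER BOUND of sector `N` for `J ≥ 0` … [cite: GeorgesMediciMravlje2013, Table 1 (boxed ground multiplets, «for J > 0»)] -/
theorem e0Hund_le {U J : ℝ} (hJ : 0 ≤ J) : ∀ t ∈ terms, e0Hund U J t.N ≤ energy U J t := by
  obtain ⟨h0, h1, h2, h3, h4, h5, h6, h7, h8, h9, h10, h11, h12⟩ := energy_values U J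
  intro t ht
  simp only [terms, List.mem_cons, List.not_mem_nil, or_false] at ht
  rcases ht with rfl | rfl | rfl | rfl | rfl | rfl | rfl | rfl | rfl | rfl | rfl | rfl | rfl <;>
    simp only [p0, p1, p2P, p2D, p2S, p3S, p3D, p3P, p4P, p4D, p4S, p5, p6, e0Hund] at * <;> linarith

/-- … and it is ATTAINED, by the Hund terms `p0, p1, p2P, p3S, p4P, p5, p6`.
[cite: GeorgesMediciMravlje2013, Table 1 (boxed ground multiplets)] -/
theorem e0Hund_attained (U J : ℝ) :
    energy U J p0 = e0Hund U J 0 ∧ energy U J p1 = e0Hund U J 1 ∧ energy U J p2P = e0Hund U J 2 ∧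
    energy U J p3S = e0Hund U J 3 ∧ energy U J p4P = e0Hund U J 4 ∧ energy U J p5 = e0Hund U J 5 ∧
    energy U J p6 = e0Hund U J 6 := by
  obtain ⟨h0, h1, h2, -, -, h5, -, -, h8, -, -, h11, h12⟩ := energy_values U J
  simp only [e0Hund]
  exact ⟨h0, h1, h2, h5, h8, h11, h12⟩

/-- `e0Inv N` is a LOWER BOUND of sector `N` for `J ≤ 0` … [cite: CaponeEtAl2009, §II–§IV (low-spin ground states) with GeorgesMediciMravlje2013 eq. (7)] -/
theorem e0Inv_le {U J : ℝ} (hJ : J ≤ 0) : ∀ t ∈ terms, e0Inv U J t.N ≤ energy U J t := by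
  obtain ⟨h0, h1, h2, h3, h4, h5, h6, h7, h8, h9, h10, h11, h12⟩ := energy_values U J
  intro t ht
  simp only [terms, List.mem_cons, List.not_mem_nil, or_false] at ht
  rcases ht with rfl | rfl | rfl | rfl | rfl | rfl | rfl | rfl | rfl | rfl | rfl | rfl | rfl <;>
    simp only [p0, p1, p2P, p2D, p2S, p3S, p3D, p3P, p4P, p4D, p4S, p5, p6, e0Inv] at * <;> linarith

/-- … and it is ATTAINED, by the inverted ground terms `p0, p1, p2S, p3P, p4S, p5, p6` (singlet, low-spin
doublet, singlet at `N = 2, 3, 4`). [cite: CaponeEtAl2009, §II–§IV] -/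
theorem e0Inv_attained (U J : ℝ) :
    energy U J p0 = e0Inv U J 0 ∧ energy U J p1 = e0Inv U J 1 ∧ energy U J p2S = e0Inv U J 2 ∧
    energy U J p3P = e0Inv U J 3 ∧ energy U J p4S = e0Inv U J 4 ∧ energy U J p5 = e0Inv U J 5 ∧
    energy U J p6 = e0Inv U J 6 := by
  obtain ⟨h0, h1, -, -, h4, -, -, h7, -, -, h10, h11, h12⟩ := energy_values U J
  simp only [e0Inv]
  exact ⟨h0, h1, h4, h7, h10, h11, h12⟩

/-- The atomic charge gap `Δ_at(N) = E₀(N+1) + E₀(N−1) − 2E₀(N)` built on a sector ground-energy function.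
[cite: GeorgesMediciMravlje2013, §3 (first displayed equation)] -/
def gap (e0 : ℕ → ℝ) (N : ℕ) : ℝ := e0 (N + 1) + e0 (N - 1) - 2 * e0 N

/-- HUND GAPS (`J ≥ 0` ground terms): `Δ_at = U − 3J` at `N = 1, 2, 4, 5` and `U + 2J` at `N = 3`.
[cite: GeorgesMediciMravlje2013, §3 («U_eff = U − 3J» for N ≠ M, «U + (M−1)J» for N = M, here M = 3)] -/
theorem gap_hund (U J : ℝ) :
    gap (e0Hund U J) 1 = U - 3 * J ∧ gap (e0Hund U J) 2 = U - 3 * J ∧ gap (e0Hund U J) 3 = U + 2 * J ∧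
    gap (e0Hund U J) 4 = U - 3 * J ∧ gap (e0Hund U J) 5 = U - 3 * J := by
  simp only [gap, e0Hund]
  refine ⟨?_, ?_, ?_, ?_, ?_⟩ <;> ring

/-- INVERTED-HUND GAPS (`J ≤ 0` ground terms): `Δ_at = U + 2J (= U − 2|J|)` at `N = 1, 3, 5` and
`U − 8J (= U + 8|J|)` at `N = 2, 4` — the inverted coupling LOWERS the cost of charge fluctuations of the
half-filled shell (A₃C₆₀) and RAISES it for the `N = 2, 4` shells.
[cite: CaponeEtAl2009, §IV («A = −10J/3 + U», the half-filled amplitude in their letters; cf. `capone_gaps`) with GeorgesMediciMravlje2013 eq. (7)] -/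
theorem gap_inv (U J : ℝ) :
    gap (e0Inv U J) 1 = U + 2 * J ∧ gap (e0Inv U J) 2 = U - 8 * J ∧ gap (e0Inv U J) 3 = U + 2 * J ∧
    gap (e0Inv U J) 4 = U - 8 * J ∧ gap (e0Inv U J) 5 = U + 2 * J := by
  simp only [gap, e0Inv]
  refine ⟨?_, ?_, ?_, ?_, ?_⟩ <;> ring

/-- The half-filled gap is `U + 2J` for EITHER sign of `J` (with the sign-appropriate ground terms): Hund
raises it, inverted Hund lowers it, by the same `2|J|`. [cite: GeorgesMediciMravlje2013, §3 with CaponeEtAl2009 §IV] -/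
theorem gap_half_both_signs (U J : ℝ) : gap (e0Hund U J) 3 = U + 2 * J ∧ gap (e0Inv U J) 3 = U + 2 * J :=
  ⟨(gap_hund U J).2.2.1, (gap_inv U J).2.2.1⟩

/-- Corollary in magnitudes: for `J < 0` the half-filled gap lies BELOW `U` and the `N = 2, 4` gaps ABOVE `U`;
for `J > 0` it is the other way round at half filling and the generic gap `U − 3J` lies below `U`.
[cite: GeorgesMediciMravlje2013, §3 («Janus») with CaponeEtAl2009 §II] -/
theorem gap_vs_U (U J : ℝ) :
    (J < 0 → gap (e0Inv U J) 3 < U ∧ U < gap (e0Inv U J) 2 ∧ U < gap (e0Inv U J) 4) ∧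
    (0 < J → U < gap (e0Hund U J) 3 ∧ gap (e0Hund U J) 2 < U ∧ gap (e0Hund U J) 4 < U) := by
  obtain ⟨-, g2, g3, g4, -⟩ := gap_inv U J
  obtain ⟨-, k2, k3, k4, -⟩ := gap_hund U J
  rw [g2, g3, g4, k2, k3, k4]
  constructor
  · intro hJ; exact ⟨by linarith, by linarith, by linarith⟩
  · intro hJ; exact ⟨by linarith, by linarith, by linarith⟩

/-! ## Cross-check against the density–density computation of `KanamoriAtomicMottGap` -/

/-- The Hund ground-term energy of eq. (7) EQUALS the density–density Kanamori energy of the maximal-`S_z`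
pattern `hund 3 N` (with `U' = U − 2J`) in every sector `N ≤ 6` — GdMM's «the exchange and pair-hopping terms
have no action on those states», certified here at the level of energies for `M = 3`.
[cite: GeorgesMediciMravlje2013, §3 (E₀(N) by pair counting) and eq. (7)] -/
theorem e0Hund_eq_ddEnergy_hund (U J : ℝ) (N : ℕ) (hN : N ≤ 6) :
    e0Hund U J N = KanamoriAtomicMottGap.ddEnergy U (U - 2 * J) J 3 (KanamoriAtomicMottGap.hund 3 N) := by
  interval_cases N
  · rw [KanamoriAtomicMottGap.groundEnergy_le_rot U (U - 2 * J) J rfl (by norm_num : 0 ≤ 3)]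
    simp [e0Hund]
  · rw [KanamoriAtomicMottGap.groundEnergy_le_rot U (U - 2 * J) J rfl (by norm_num : 1 ≤ 3)]
    simp [e0Hund]
  · rw [KanamoriAtomicMottGap.groundEnergy_le_rot U (U - 2 * J) J rfl (by norm_num : 2 ≤ 3)]
    simp only [e0Hund]; push_cast; ring
  · rw [KanamoriAtomicMottGap.groundEnergy_le_rot U (U - 2 * J) J rfl (by norm_num : 3 ≤ 3)]
    simp only [e0Hund]; push_cast; ring
  · rw [show (4 : ℕ) = 3 + 1 by norm_num,
      KanamoriAtomicMottGap.ddEnergy_hund_ge U (U - 2 * J) J (M := 3) (k := 1) (by norm_num)]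
    simp only [e0Hund]; norm_num [Nat.choose]; ring
  · rw [show (5 : ℕ) = 3 + 2 by norm_num,
      KanamoriAtomicMottGap.ddEnergy_hund_ge U (U - 2 * J) J (M := 3) (k := 2) (by norm_num)]
    simp only [e0Hund]; norm_num [Nat.choose]; ring
  · rw [show (6 : ℕ) = 3 + 3 by norm_num,
      KanamoriAtomicMottGap.ddEnergy_hund_ge U (U - 2 * J) J (M := 3) (k := 3) (by norm_num)]
    simp only [e0Hund]; norm_num [Nat.choose]; ring

/-- The Hund gaps of this file are the `t₂g` gaps of `KanamoriAtomicMottGap` (`U − 3J`, `U + 2J`).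
[cite: GeorgesMediciMravlje2013, §3] -/
theorem gap_hund_eq_atomicGap (U J : ℝ) (N : ℕ) (h1 : 1 ≤ N) (h5 : N ≤ 5) :
    gap (e0Hund U J) N = KanamoriAtomicMottGap.atomicGap U (U - 2 * J) J 3 N := by
  obtain ⟨a1, a2, a3, a4, a5⟩ := KanamoriAtomicMottGap.t2g_gaps U (U - 2 * J) J rfl
  obtain ⟨g1, g2, g3, g4, g5⟩ := gap_hund U J
  interval_cases N
  · rw [g1, a1]
  · rw [g2, a2]
  · rw [g3, a3]
  · rw [g4, a4]
  · rw [g5, a5]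

/-! ## The fulleride parameterisation of Capone–Fabrizio–Castellani–Tosatti and the dictionary -/

/-- CFCT eqs. (1)–(2) evaluated on a term: `H_U + H_J = (U/2)(n−3)² + J(2S(S+1) + ½L(L+1)) + (5/6)J(n−3)²`
(their `J = −J_H + J_JT`; `J > 0` = inverted). [cite: CaponeEtAl2009, §III eqs. (1)–(2)] -/
def caponeEnergy (U J : ℝ) (t : Term) : ℝ :=
  U / 2 * ((t.N : ℝ) - 3) ^ 2 + J * (2 * spinSq t + orbSq t / 2) + 5 / 6 * J * ((t.N : ℝ) - 3) ^ 2

/-- THE DICTIONARY (exact): with `U_C = U − (4/3)J` and `J_C = −J`, CFCT's energy equals GdMM's eq. (7) up to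
an affine function of `N`: `E_C = E − (5/2)(U − 2J) N + (9/2)(U − 3J)`. Hence both forms have the same level
order in every sector and the same second differences (gaps); but «U» is NOT the same number in the two papers
when `J ≠ 0`. [cite: CaponeEtAl2009, §III eqs. (1)–(2); GeorgesMediciMravlje2013, eq. (7)] -/
theorem caponeEnergy_eq (U J : ℝ) (t : Term) :
    caponeEnergy (U - 4 / 3 * J) (-J) t =
      energy U J t - 5 / 2 * (U - 2 * J) * (t.N : ℝ) + 9 / 2 * (U - 3 * J) := by
  simp only [caponeEnergy, energy, tableEnergy]
  ring

/-- CFCT values in THEIR letters (`U`, `J` of eqs. (1)–(2)): `n = 3`: ⁴S `15J/2`, ²D `9J/2`, ²P `5J/2`;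
`n = 2, 4`: `U/2 + 5J/6 +` (³P `5J`, ¹D `3J`, ¹S `0`); `n = 1, 5`: `2U + 10J/3 + 5J/2`; `n = 0, 6`: `9U/2 + 15J/2`.
[cite: CaponeEtAl2009, §III eqs. (1)–(2)] -/
theorem caponeEnergy_values (U J : ℝ) :
    caponeEnergy U J p3S = 15 / 2 * J ∧ caponeEnergy U J p3D = 9 / 2 * J ∧ caponeEnergy U J p3P = 5 / 2 * J ∧
    caponeEnergy U J p2P = U / 2 + 5 / 6 * J + 5 * J ∧ caponeEnergy U J p2D = U / 2 + 5 / 6 * J + 3 * J ∧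
    caponeEnergy U J p2S = U / 2 + 5 / 6 * J ∧
    caponeEnergy U J p4P = U / 2 + 5 / 6 * J + 5 * J ∧ caponeEnergy U J p4D = U / 2 + 5 / 6 * J + 3 * J ∧
    caponeEnergy U J p4S = U / 2 + 5 / 6 * J ∧
    caponeEnergy U J p1 = 2 * U + 10 / 3 * J + 5 / 2 * J ∧ caponeEnergy U J p5 = 2 * U + 10 / 3 * J + 5 / 2 * J ∧
    caponeEnergy U J p0 = 9 / 2 * U + 15 / 2 * J ∧ caponeEnergy U J p6 = 9 / 2 * U + 15 / 2 * J := by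
  simp only [caponeEnergy, spinSq, orbSq, p0, p1, p2P, p2D, p2S, p3S, p3D, p3P, p4P, p4D, p4S, p5, p6]
  push_cast
  refine ⟨?_, ?_, ?_, ?_, ?_, ?_, ?_, ?_, ?_, ?_, ?_, ?_, ?_⟩ <;> ring

/-- CFCT SPIN GAPS: high-spin minus low-spin `= 5J` at `n = 3` (⁴S − ²P) AND at `n = 4` (³P − ¹S), as printed
(«to be consistent with our model where both gaps are equal to 5J»); with the observed `≈ 0.1 eV` spin gap this is
their `J ≈ 0.02 eV`. [cite: CaponeEtAl2009, §IV] -/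
theorem capone_spinGaps (U J : ℝ) :
    caponeEnergy U J p3S - caponeEnergy U J p3P = 5 * J ∧ caponeEnergy U J p4P - caponeEnergy U J p4S = 5 * J := by
  obtain ⟨h3S, -, h3P, -, -, -, h4P, -, h4S, -⟩ := caponeEnergy_values U J
  rw [h3S, h3P, h4P, h4S]
  constructor <;> ring

/-- `5J = 0.1 eV ↔ J = 0.02 eV` (the printed inference). [cite: CaponeEtAl2009, §IV («J = 0.02 eV»)] -/
theorem capone_J_from_spinGap (J : ℝ) : 5 * J = 0.1 ↔ J = 0.02 := by
  constructor <;> intro h <;> linarith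

/-- CFCT ground energies for `J ≥ 0` in their convention (inverted order: ¹S, ²P, ¹S at `n = 2, 3, 4`; single
terms at `n = 1, 5`; closed shells otherwise). [cite: CaponeEtAl2009, §II–§IV] -/
def e0Capone (U J : ℝ) : ℕ → ℝ
  | 1 => 2 * U + 10 / 3 * J + 5 / 2 * J
  | 2 => U / 2 + 5 / 6 * J
  | 3 => 5 / 2 * J
  | 4 => U / 2 + 5 / 6 * J
  | 5 => 2 * U + 10 / 3 * J + 5 / 2 * J
  | _ => 9 / 2 * U + 15 / 2 * J

/-- `e0Capone N` is a lower bound of every sector for `J ≥ 0` (their inverted regime) …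
[cite: CaponeEtAl2009, §III («an inverted Hund's rule coupling»)] -/
theorem e0Capone_le {U J : ℝ} (hJ : 0 ≤ J) : ∀ t ∈ terms, e0Capone U J t.N ≤ caponeEnergy U J t := by
  obtain ⟨h3S, h3D, h3P, h2P, h2D, h2S, h4P, h4D, h4S, h1, h5, h0, h6⟩ := caponeEnergy_values U J
  intro t ht
  simp only [terms, List.mem_cons, List.not_mem_nil, or_false] at ht
  rcases ht with rfl | rfl | rfl | rfl | rfl | rfl | rfl | rfl | rfl | rfl | rfl | rfl | rfl <;>
    simp only [p0, p1, p2P, p2D, p2S, p3S, p3D, p3P, p4P, p4D, p4S, p5, p6, e0Capone] at * <;> linarith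

/-- … attained by `p0, p1, p2S, p3P, p4S, p5, p6`. [cite: CaponeEtAl2009, §II–§IV] -/
theorem e0Capone_attained (U J : ℝ) :
    caponeEnergy U J p0 = e0Capone U J 0 ∧ caponeEnergy U J p1 = e0Capone U J 1 ∧
    caponeEnergy U J p2S = e0Capone U J 2 ∧ caponeEnergy U J p3P = e0Capone U J 3 ∧
    caponeEnergy U J p4S = e0Capone U J 4 ∧ caponeEnergy U J p5 = e0Capone U J 5 ∧
    caponeEnergy U J p6 = e0Capone U J 6 := by
  obtain ⟨-, -, h3P, -, -, h2S, -, -, h4S, h1, h5, h0, h6⟩ := caponeEnergy_values U J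
  simp only [e0Capone]
  exact ⟨h0, h1, h2S, h3P, h4S, h5, h6⟩

/-- CFCT GAPS in their letters (`J ≥ 0`, inverted ground terms): half filling `Δ_at(3) = U − (10/3)J` — the
atomic-limit counterpart of their Cooper-channel amplitude «A = −10J/3 + U» — and `Δ_at(2) = Δ_at(4) = U + (20/3)J`.
[cite: CaponeEtAl2009, §IV («A = −10J/3 + U»)] -/
theorem capone_gaps (U J : ℝ) :
    gap (e0Capone U J) 3 = U - 10 / 3 * J ∧ gap (e0Capone U J) 2 = U + 20 / 3 * J ∧
    gap (e0Capone U J) 4 = U + 20 / 3 * J := by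
  simp only [gap, e0Capone]
  refine ⟨?_, ?_, ?_⟩ <;> ring

/-- Consistency of the two gap tables through the dictionary: `U_C − (10/3)J_C = U + 2J` and
`U_C + (20/3)J_C = U − 8J` when `U_C = U − (4/3)J`, `J_C = −J`. [cite: CaponeEtAl2009, §III–§IV; GeorgesMediciMravlje2013, §3] -/
theorem capone_gaps_dictionary (U J : ℝ) :
    gap (e0Capone (U - 4 / 3 * J) (-J)) 3 = gap (e0Inv U J) 3 ∧
    gap (e0Capone (U - 4 / 3 * J) (-J)) 2 = gap (e0Inv U J) 2 ∧
    gap (e0Capone (U - 4 / 3 * J) (-J)) 4 = gap (e0Inv U J) 4 := by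
  obtain ⟨c3, c2, c4⟩ := capone_gaps (U - 4 / 3 * J) (-J)
  obtain ⟨-, g2, g3, g4, -⟩ := gap_inv U J
  rw [c3, c2, c4, g2, g3, g4]
  refine ⟨?_, ?_, ?_⟩ <;> ring

/-- THE PRINTED RANGES DO NOT FIX THE SIGN: with `J_H ∈ [0.03, 0.1]` and `J_JT ∈ [0.06, 0.12]` eV (as printed),
`J_C = J_JT − J_H` ranges over `[−0.04, 0.09]` eV by corners — both signs occur inside the box; CFCT fix the
(inverted) sign by the further constraints they list (s-wave pairing, `S = ½` Mott insulator, `≈ 0.1 eV` spin gap).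
[cite: CaponeEtAl2009, §III («J_H ≃ 0.03 − 0.1 eV … J_JT ≃ 0.06 − 0.12 eV»)] -/
theorem capone_J_interval (jH jJT : ℝ) (h1 : 0.03 ≤ jH) (h2 : jH ≤ 0.1) (h3 : 0.06 ≤ jJT) (h4 : jJT ≤ 0.12) :
    -0.04 ≤ jJT - jH ∧ jJT - jH ≤ 0.09 := by
  constructor <;> linarith

/-- Both corner signs are realised: `(J_H, J_JT) = (0.1, 0.06)` gives `J_C = −0.04 < 0` (Hund wins) and
`(0.03, 0.12)` gives `J_C = 0.09 > 0` (Jahn–Teller wins). [cite: CaponeEtAl2009, §III (the two printed ranges)] -/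
theorem capone_J_corners : (0.06 : ℝ) - 0.1 < 0 ∧ (0 : ℝ) < 0.12 - 0.03 := by
  constructor <;> norm_num

/-- WORKED NUMBERS in CFCT letters at the printed scales `U ∼ 1 eV`, `J = 0.02 eV`: half-filled atomic gap
`1 − 0.2/3 ≈ 0.933 eV` (`< U`), `n = 2, 4` gaps `1 + 0.4/3 ≈ 1.133 eV` (`> U`), spin gap `0.1 eV`.
[cite: CaponeEtAl2009, §III («U ∼ 1eV»), §IV («J = 0.02 eV»)] -/
theorem capone_worked (U J : ℝ) (hU : U = 1) (hJ : J = 0.02) :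
    gap (e0Capone U J) 3 = 1 - 0.2 / 3 ∧ gap (e0Capone U J) 2 = 1 + 0.4 / 3 ∧
    caponeEnergy U J p3S - caponeEnergy U J p3P = 0.1 := by
  obtain ⟨c3, c2, -⟩ := capone_gaps U J
  obtain ⟨s3, -⟩ := capone_spinGaps U J
  subst hU; subst hJ
  rw [c3, c2, s3]
  norm_num

end KanamoriT2gSpectrum

end Literature.MathematicalPhysics.QuantumManyBody

end
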